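import Summits.AtomisticToContinuum.Crystallization.Theorems.FrustratedLawDichotomyStrainedPatchHomTermSqrt
import Summits.AtomisticToContinuum.Crystallization.Theorems.FrustratedLawDichotomyStrainedPatchHomTermEvalPoint

/-!
# Window-safe (v2) reflected term checks: `winOK2`, `curvOK2`, `valLoOK2`, `derivOK2` — the v1 checks with `FI.sqrt ↦ sqrtW`

decomp-a2c hand-2 g21 (crux `AperiodicFrustratedLawGap`, stmt-AtomisticToContinuum-27623).  `…TermSqrt` records the finding that the Literature `FI.sqrt` is tight
only below `16` (scale `2^48`) and supplies the range-safe `sqrtW` with the same two endpoint lemmas.  This module is the v1 term layer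
(`…TermEval.winOK/curvOK`, `…TermEvalPoint.valLoOK/derivOK`) with every window-regime square root taken by `sqrtW` — definitions and soundness proofs are
otherwise VERBATIM (the bump/LJ/far pieces are reused from v1 unchanged).  With these, window terms up to `q = 81/4` (`r = 9/2`) get tight enclosures.
Computable; `decide +kernel` smoke tests at `q > 16`; 0 sorry; standard axioms.  `--supports stmt-AtomisticToContinuum-27623`.
-/

namespace Summit.AtomisticToContinuum.Crystallization.Theorems.FrustratedLawDichotomyStrainedPatchHomTermEvalW

open Set
open Literature.Analysis.ValidatedNumerics.Numerics
open Summit.AtomisticToContinuum.Crystallization.Theorems.FrustratedLawDichotomySchurCut (effPot w₄₅ ω₄)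
open Summit.AtomisticToContinuum.Crystallization.Theorems.FrustratedLawDichotomyStrainedPatchHomTermCalculus (monotoneOn_Icc_of_pieces)
open Summit.AtomisticToContinuum.Crystallization.Theorems.FrustratedLawDichotomyStrainedPatchHomTermCalculusSq
open Summit.AtomisticToContinuum.Crystallization.Theorems.FrustratedLawDichotomyStrainedPatchHomTermPointBounds
open Summit.AtomisticToContinuum.Crystallization.Theorems.FrustratedLawDichotomyStrainedPatchHomTermEval
open Summit.AtomisticToContinuum.Crystallization.Theorems.FrustratedLawDichotomyStrainedPatchHomTermEvalPoint
open Summit.AtomisticToContinuum.Crystallization.Theorems.FrustratedLawDichotomyStrainedPatchHomTermSqrt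

/-! ## §1. Window piece and term curvature check, v2 -/

/-- **Window piece check, v2** (`sqrtW`). -/
def winOK2 (A B : FI) (M : ℤ) : Bool :=
  decide (0 < (sqrtW A).lo) && decide (0 < (sqrtW B).hi) && decide ((eWin (sqrtW A).lo (sqrtW B).hi).hi ≤ M)

/-- Soundness of the v2 window piece check: `hmono` on `[a, b] ⊂ [9, 81/4]` with constant `M/SC`. [folklore] -/
theorem winOK2_sound {a b : ℝ} {A B : FI} {M : ℤ} (ha : FI.mem a A) (hb : FI.mem b B) (h9 : 9 ≤ a) (h81 : b ≤ 81 / 4)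
    (h : winOK2 A B M = true) :
    MonotoneOn (fun t => deriv (effPot w₄₅ ω₄ (3 / 400)) (Real.sqrt t) / (2 * Real.sqrt t) + (M : ℝ) / SC * t) (Icc a b) := by
  simp only [winOK2, Bool.and_eq_true, decide_eq_true_eq] at h
  obtain ⟨⟨hS1, hS2⟩, hM⟩ := h
  have hs1 : (0:ℝ) < ((sqrtW A).lo : ℝ) / SC := div_pos (by exact_mod_cast hS1) SC_pos
  have h1 := sqrtWLo_sq_le ha hS1
  obtain ⟨h2, hs2⟩ := le_sqrtWHi_sq hb hS2.le
  have hle := FI.le_hi_div (mem_eWin hS1 hS2)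
  have hM' : ((eWin (sqrtW A).lo (sqrtW B).hi).hi : ℝ) / SC ≤ (M : ℝ) / SC :=
    div_le_div_of_nonneg_right (by exact_mod_cast hM) SC_pos.le
  exact monotoneOn_dphi45_window h9 h81 hs1 h1 h2 hs2 (hle.trans hM')

/-- ★ **THE TERM CURVATURE CHECK, v2** (window pieces by `winOK2`) for a term with squared-length range `[qlo/SC, qhi/SC]` and candidate constant `M/SC`:
`M ≥ 0`, `qlo > 0`, `qlo ≤ qhi`, then by integer comparison with `64/25, 9, 81/4`: a single-regime range is checked by that regime's piece check;
a range straddling ONE breakpoint is split there (pieces checked with the exact breakpoint as an `FI.ofFrac` endpoint); anything wider is refused. -/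
def curvOK2 (qlo qhi M : ℤ) : Bool :=
  let A := FI.ofScaled qlo
  let B := FI.ofScaled qhi
  decide (0 ≤ M) && decide (0 < qlo) && decide (qlo ≤ qhi) &&
    (if 25 * qhi ≤ 64 * (SC : ℤ) then bumpOK A B M
    else if 64 * (SC : ℤ) ≤ 25 * qlo then
      (if qhi ≤ 9 * (SC : ℤ) then ljOK A B M
      else if 9 * (SC : ℤ) ≤ qlo then
        (if 4 * qhi ≤ 81 * (SC : ℤ) then winOK2 A B M
        else if 81 * (SC : ℤ) ≤ 4 * qlo then true
        else winOK2 A (FI.ofFrac 81 4) M)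
      else decide (4 * qhi ≤ 81 * (SC : ℤ)) && ljOK A (FI.ofInt 9) M && winOK2 (FI.ofInt 9) B M)
    else decide (qhi ≤ 9 * (SC : ℤ)) && bumpOK A (FI.ofFrac 64 25) M && ljOK (FI.ofFrac 64 25) B M)

/-- ★★ **SOUNDNESS OF THE v2 TERM CURVATURE CHECK**: `curvOK2 qlo qhi M = true` delivers the `hM`/`hmono` inputs of `…HomCentredForm.leaf_sound_box` for a term
with squared-length range `[qlo/SC, qhi/SC]`: `0 ≤ M/SC` and `φ′ + (M/SC)·id` monotone there. [folklore] -/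
theorem curvOK2_sound {qlo qhi M : ℤ} (h : curvOK2 qlo qhi M = true) :
    0 ≤ (M : ℝ) / SC ∧
      MonotoneOn (fun t => deriv (effPot w₄₅ ω₄ (3 / 400)) (Real.sqrt t) / (2 * Real.sqrt t) + (M : ℝ) / SC * t)
        (Icc ((qlo : ℝ) / SC) ((qhi : ℝ) / SC)) := by
  have ha := FI.mem_ofScaled qlo
  have hb := FI.mem_ofScaled qhi
  have hk1 : FI.mem ((64 : ℝ) / 25) (FI.ofFrac 64 25) := mem_congr (FI.mem_ofFrac 64 (q := 25) (by norm_num)) (by norm_num)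
  have hk2 : FI.mem (9 : ℝ) (FI.ofInt 9) := mem_congr (FI.mem_ofInt 9) (by norm_num)
  have hk3 : FI.mem ((81 : ℝ) / 4) (FI.ofFrac 81 4) := mem_congr (FI.mem_ofFrac 81 (q := 4) (by norm_num)) (by norm_num)
  unfold curvOK2 at h
  simp only [Bool.and_eq_true, decide_eq_true_eq] at h
  obtain ⟨⟨⟨hM0, hq0⟩, hqq⟩, h⟩ := h
  refine ⟨div_nonneg (by exact_mod_cast hM0) SC_pos.le, ?_⟩
  have hab : (qlo : ℝ) / SC ≤ (qhi : ℝ) / SC := div_le_div_of_nonneg_right (by exact_mod_cast hqq) SC_pos.le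
  split_ifs at h with c1 c2 c3 c4 c5 c6
  · -- b ≤ 64/25: bump
    exact bumpOK_sound ha hb (div_SC_le_of (by norm_num) (by simpa using c1)) h
  · -- 64/25 ≤ a, b ≤ 9: LJ
    exact ljOK_sound ha hb (le_div_SC_of (by norm_num) (by simpa using c2)) (div_SC_le_of (n := 1) (by norm_num) (by simpa using c3) |>.trans
      (by norm_num)) h
  · -- 9 ≤ a, b ≤ 81/4: window
    exact winOK2_sound ha hb ((show (9:ℝ) = (9:ℤ)/(1:ℕ) by norm_num) ▸ le_div_SC_of (by norm_num) (by simpa using c4))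
      (div_SC_le_of (by norm_num) (by simpa using c5)) h
  · -- 81/4 ≤ a: far
    exact monotoneOn_dphi45_far (le_div_SC_of (by norm_num) (by simpa using c6)) (div_nonneg (by exact_mod_cast hM0) SC_pos.le)
  · -- straddle 81/4: window on [a, 81/4], far on [81/4, b]
    have ha9 : (9 : ℝ) ≤ (qlo : ℝ) / SC := (show (9:ℝ) = (9:ℤ)/(1:ℕ) by norm_num) ▸ le_div_SC_of (by norm_num) (by simpa using c4)
    have hlt1 : (qlo : ℝ) / SC ≤ 81 / 4 := by
      have : ¬ (81 * (SC : ℤ) ≤ 4 * qlo) := c6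
      have h' : 4 * qlo ≤ 81 * (SC : ℤ) := by linarith [not_le.1 this]
      exact div_SC_le_of (by norm_num) (by simpa using h')
    have hgt1 : (81 : ℝ) / 4 ≤ (qhi : ℝ) / SC := by
      have : ¬ (4 * qhi ≤ 81 * (SC : ℤ)) := c5
      have h' : 81 * (SC : ℤ) ≤ 4 * qhi := by linarith [not_le.1 this]
      exact le_div_SC_of (by norm_num) (by simpa using h')
    exact monotoneOn_Icc_of_pieces hlt1 hgt1 (winOK2_sound ha hk3 ha9 le_rfl h)
      (monotoneOn_dphi45_far le_rfl (div_nonneg (by exact_mod_cast hM0) SC_pos.le))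
  · -- straddle 9: LJ on [a, 9], window on [9, b]
    simp only [Bool.and_eq_true, decide_eq_true_eq] at h
    obtain ⟨⟨c7, hL⟩, hW⟩ := h
    have ha64 : (64 : ℝ) / 25 ≤ (qlo : ℝ) / SC := le_div_SC_of (by norm_num) (by simpa using c2)
    have hlt : (qlo : ℝ) / SC ≤ 9 := by
      have : ¬ (9 * (SC : ℤ) ≤ qlo) := c4
      have h' : (1:ℕ) * qlo ≤ 9 * (SC : ℤ) := by push_cast; linarith [not_le.1 this]
      exact (div_SC_le_of (by norm_num) h').trans (by norm_num)
    have hgt : (9 : ℝ) ≤ (qhi : ℝ) / SC := by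
      have : ¬ (qhi ≤ 9 * (SC : ℤ)) := c3
      have h' : 9 * (SC : ℤ) ≤ (1:ℕ) * qhi := by push_cast; linarith [not_le.1 this]
      exact le_trans (by norm_num) (le_div_SC_of (by norm_num) h')
    have hb81 : (qhi : ℝ) / SC ≤ 81 / 4 := div_SC_le_of (by norm_num) (by simpa using c7)
    exact monotoneOn_Icc_of_pieces hlt hgt (ljOK_sound ha hk2 ha64 le_rfl hL) (winOK2_sound hk2 hb le_rfl hb81 hW)
  · -- straddle 64/25: bump on [a, 64/25], LJ on [64/25, b]
    simp only [Bool.and_eq_true, decide_eq_true_eq] at h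
    obtain ⟨⟨c7, hBu⟩, hL⟩ := h
    have hlt : (qlo : ℝ) / SC ≤ 64 / 25 := by
      have : ¬ (64 * (SC : ℤ) ≤ 25 * qlo) := c2
      have h' : 25 * qlo ≤ 64 * (SC : ℤ) := by linarith [not_le.1 this]
      exact div_SC_le_of (by norm_num) (by simpa using h')
    have hgt : (64 : ℝ) / 25 ≤ (qhi : ℝ) / SC := by
      have : ¬ (25 * qhi ≤ 64 * (SC : ℤ)) := c1
      have h' : 64 * (SC : ℤ) ≤ 25 * qhi := by linarith [not_le.1 this]
      exact le_div_SC_of (by norm_num) (by simpa using h')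
    have hb9 : (qhi : ℝ) / SC ≤ 9 := by
      have h' : (1:ℕ) * qhi ≤ 9 * (SC : ℤ) := by push_cast; linarith
      exact (div_SC_le_of (by norm_num) h').trans (by norm_num)
    exact monotoneOn_Icc_of_pieces hlt hgt (bumpOK_sound ha hk1 le_rfl hBu) (ljOK_sound hk1 hb le_rfl hb9 hL)

/-! ## §2. Value and derivative checks at the centre, v2 (window branch by `sqrtW`) -/

/-- `lo := (sqrtW Q).lo/SC ≥ 0` and `lo² ≤ q` for `q ≥ 0`. [folklore] -/
theorem sqrtWLo_nonneg_sq_le {q : ℝ} {Q : FI} (hq : FI.mem q Q) (h0 : 0 ≤ (sqrtW Q).lo) (hq0 : 0 ≤ q) :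
    0 ≤ ((sqrtW Q).lo : ℝ) / SC ∧ (((sqrtW Q).lo : ℝ) / SC) ^ 2 ≤ q := by
  have h1 : ((sqrtW Q).lo : ℝ) / SC ≤ Real.sqrt q := FI.lo_div_le (mem_sqrtW hq)
  have h0' : (0:ℝ) ≤ ((sqrtW Q).lo : ℝ) / SC := div_nonneg (by exact_mod_cast h0) SC_pos.le
  refine ⟨h0', ?_⟩
  calc (((sqrtW Q).lo : ℝ) / SC) ^ 2 ≤ Real.sqrt q ^ 2 := pow_le_pow_left₀ h0' h1 2
    _ = q := Real.sq_sqrt hq0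

/-- ★ **THE VALUE CHECK, v2** at the centre `q₀ = q0/SC` with hint `V` (scaled): certifies `V/SC ≤ φ(q₀)`. -/
def valLoOK2 (q0 V : ℤ) : Bool :=
  let Q := FI.ofScaled q0
  decide (0 < q0) &&
    (if 25 * q0 ≤ 64 * (SC : ℤ) then
      decide (0 ≤ (sqrtW Q).lo) && decide (0 ≤ (sqrtW Q).hi) &&
        decide (V ≤ (eBumpE1 Q).lo + min (FI.mul (eBumpC Q) (mulRat (FI.ofScaled (sqrtW Q).lo) 5 4)).lo
          (FI.mul (eBumpC Q) (mulRat (FI.ofScaled (sqrtW Q).hi) 5 4)).lo)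
    else if q0 ≤ 9 * (SC : ℤ) then decide (V ≤ (eVq Q).lo)
    else if 4 * q0 ≤ 81 * (SC : ℤ) then decide (0 ≤ (sqrtW Q).hi) && decide (V ≤ (eWinVal Q (sqrtW Q).hi).lo)
    else decide (V ≤ 0))

/-- ★★ **SOUNDNESS OF THE v2 VALUE CHECK**: `valLoOK2 q0 V = true → V/SC ≤ φ(q0/SC)`. [folklore] -/
theorem valLoOK2_sound {q0 V : ℤ} (h : valLoOK2 q0 V = true) :
    (V : ℝ) / SC ≤ effPot w₄₅ ω₄ (3 / 400) (Real.sqrt ((q0 : ℝ) / SC)) := by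
  have hq := FI.mem_ofScaled q0
  unfold valLoOK2 at h
  simp only [Bool.and_eq_true, decide_eq_true_eq] at h
  obtain ⟨hq0, h⟩ := h
  have hQ : 0 < (FI.ofScaled q0).lo := hq0
  have hpos : (0:ℝ) < (q0 : ℝ) / SC := div_pos (by exact_mod_cast hq0) SC_pos
  split_ifs at h with c1 c2 c3
  · -- bump
    simp only [Bool.and_eq_true, decide_eq_true_eq] at h
    obtain ⟨⟨hS1, hS2⟩, hV⟩ := h
    set p₁ := (FI.mul (eBumpC (FI.ofScaled q0)) (mulRat (FI.ofScaled (sqrtW (FI.ofScaled q0)).lo) 5 4)).lo with hp₁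
    set p₂ := (FI.mul (eBumpC (FI.ofScaled q0)) (mulRat (FI.ofScaled (sqrtW (FI.ofScaled q0)).hi) 5 4)).lo with hp₂
    have h64 : (q0 : ℝ) / SC ≤ 64 / 25 := div_SC_le_of (by norm_num) (by simpa using c1)
    obtain ⟨hlo0, hlo2⟩ := sqrtWLo_nonneg_sq_le hq hS1 hpos.le
    obtain ⟨hhi2, hhi0⟩ := le_sqrtWHi_sq hq hS2
    have hC := mem_eBumpC hq
    have hP1 := FI.lo_div_le (FI.mem_mul hC (mem_mulRat (FI.mem_ofScaled (sqrtW (FI.ofScaled q0)).lo) 5 (q := 4) (by norm_num)))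
    have hP2 := FI.lo_div_le (FI.mem_mul hC (mem_mulRat (FI.mem_ofScaled (sqrtW (FI.ofScaled q0)).hi) 5 (q := 4) (by norm_num)))
    rw [← hp₁] at hP1
    rw [← hp₂] at hP2
    have hm1 : ((min p₁ p₂ : ℤ) : ℝ) ≤ p₁ := by exact_mod_cast min_le_left p₁ p₂
    have hm2 : ((min p₁ p₂ : ℤ) : ℝ) ≤ p₂ := by exact_mod_cast min_le_right p₁ p₂
    have hB1 : ((min p₁ p₂ : ℤ) : ℝ) / SC ≤
        -(3 / 200) * ((25 * ((q0 : ℝ) / SC) / 16) ^ 2 * (-(77 / 64) + 33 / 256 * (25 * ((q0 : ℝ) / SC) / 16) -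
          11 / 1024 * (25 * ((q0 : ℝ) / SC) / 16) ^ 2 + 5 / 12288 * (25 * ((q0 : ℝ) / SC) / 16) ^ 3)) *
          (5 * (((sqrtW (FI.ofScaled q0)).lo : ℝ) / SC) / 4) :=
      (div_le_div_of_nonneg_right hm1 SC_pos.le).trans (hP1.trans (le_of_eq (by ring)))
    have hB2 : ((min p₁ p₂ : ℤ) : ℝ) / SC ≤
        -(3 / 200) * ((25 * ((q0 : ℝ) / SC) / 16) ^ 2 * (-(77 / 64) + 33 / 256 * (25 * ((q0 : ℝ) / SC) / 16) -
          11 / 1024 * (25 * ((q0 : ℝ) / SC) / 16) ^ 2 + 5 / 12288 * (25 * ((q0 : ℝ) / SC) / 16) ^ 3)) *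
          (5 * (((sqrtW (FI.ofScaled q0)).hi : ℝ) / SC) / 4) :=
      (div_le_div_of_nonneg_right hm2 SC_pos.le).trans (hP2.trans (le_of_eq (by ring)))
    have hmain := phi45_bump_ge_of_endpoints hpos.le h64 hlo0 hlo2 hhi0 hhi2 hB1 hB2
    have hE1 := FI.lo_div_le (mem_eBumpE1 hq hQ)
    refine le_trans ?_ hmain
    have hV' : (V : ℝ) ≤ ((eBumpE1 (FI.ofScaled q0)).lo : ℝ) + ((min p₁ p₂ : ℤ) : ℝ) := by exact_mod_cast hV
    have := div_le_div_of_nonneg_right hV' SC_pos.le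
    rw [add_div] at this
    linarith
  · -- LJ
    simp only [decide_eq_true_eq] at h
    have h64 : (64 : ℝ) / 25 ≤ (q0 : ℝ) / SC := by
      have : ¬ (25 * q0 ≤ 64 * (SC : ℤ)) := c1
      have h' : 64 * (SC : ℤ) ≤ 25 * q0 := by linarith [not_le.1 this]
      exact le_div_SC_of (by norm_num) (by simpa using h')
    have h9 : (q0 : ℝ) / SC ≤ 9 := by
      have h' : (1:ℕ) * q0 ≤ 9 * (SC : ℤ) := by push_cast; linarith
      exact (div_SC_le_of (by norm_num) h').trans (by norm_num)
    rw [phi45_eq_lj h64 h9]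
    exact le_trans (div_le_div_of_nonneg_right (by exact_mod_cast h) SC_pos.le) (FI.lo_div_le (mem_eVq hq hQ))
  · -- window
    simp only [Bool.and_eq_true, decide_eq_true_eq] at h
    obtain ⟨hS2, hV⟩ := h
    have h9 : (9 : ℝ) ≤ (q0 : ℝ) / SC := by
      have : ¬ (q0 ≤ 9 * (SC : ℤ)) := c2
      have h' : 9 * (SC : ℤ) ≤ (1:ℕ) * q0 := by push_cast; linarith [not_le.1 this]
      exact le_trans (by norm_num) (le_div_SC_of (by norm_num) h')
    have h81 : (q0 : ℝ) / SC ≤ 81 / 4 := div_SC_le_of (by norm_num) (by simpa using c3)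
    obtain ⟨hhi2, hhi0⟩ := le_sqrtWHi_sq hq hS2
    have hmain := phi45_window_ge h9 h81 hhi0 hhi2
    refine le_trans ?_ hmain
    exact le_trans (div_le_div_of_nonneg_right (by exact_mod_cast hV) SC_pos.le) (FI.lo_div_le (mem_eWinVal hq hQ))
  · -- far
    simp only [decide_eq_true_eq] at h
    have h81 : (81 : ℝ) / 4 ≤ (q0 : ℝ) / SC := by
      have : ¬ (4 * q0 ≤ 81 * (SC : ℤ)) := c3
      have h' : 81 * (SC : ℤ) ≤ 4 * q0 := by linarith [not_le.1 this]
      exact le_div_SC_of (by norm_num) (by simpa using h')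
    rw [phi45_eq_far h81]
    have : (V : ℝ) ≤ 0 := by exact_mod_cast h
    exact div_nonpos_of_nonpos_of_nonneg this SC_pos.le

/-- ★ **THE DERIVATIVE CHECK, v2** at the centre `q₀ = q0/SC` with hints `Dlo, Dhi` (scaled): certifies `φ′(q₀) ∈ [Dlo/SC, Dhi/SC]`. -/
def derivOK2 (q0 Dlo Dhi : ℤ) : Bool :=
  let Q := FI.ofScaled q0
  decide (0 < q0) &&
    (if 25 * q0 ≤ 64 * (SC : ℤ) then
      let P1 := FI.mul (eBumpC2 Q) (mulRat (FI.ofScaled (sqrtW Q).lo) 5 4)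
      let P2 := FI.mul (eBumpC2 Q) (mulRat (FI.ofScaled (sqrtW Q).hi) 5 4)
      decide (0 ≤ (sqrtW Q).lo) && decide (0 ≤ (sqrtW Q).hi) &&
        decide (Dlo ≤ (eBumpE2 Q).lo + min P1.lo P2.lo) && decide ((eBumpE2 Q).hi + max P1.hi P2.hi ≤ Dhi)
    else if q0 ≤ 9 * (SC : ℤ) then decide (Dlo ≤ (eGlj Q).lo) && decide ((eGlj Q).hi ≤ Dhi)
    else if 4 * q0 ≤ 81 * (SC : ℤ) then
      decide (0 < (sqrtW Q).lo) && decide (0 ≤ (sqrtW Q).hi) &&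
        decide (Dlo ≤ (eWinDer (sqrtW Q).hi (sqrtW Q).lo).lo) && decide ((eWinDer (sqrtW Q).lo (sqrtW Q).hi).hi ≤ Dhi)
    else decide (Dlo ≤ 0) && decide (0 ≤ Dhi))

/-- ★★ **SOUNDNESS OF THE v2 DERIVATIVE CHECK**: `derivOK2 q0 Dlo Dhi = true → φ′(q0/SC) ∈ Icc (Dlo/SC) (Dhi/SC)`. [folklore] -/
theorem derivOK2_sound {q0 Dlo Dhi : ℤ} (h : derivOK2 q0 Dlo Dhi = true) :
    deriv (effPot w₄₅ ω₄ (3 / 400)) (Real.sqrt ((q0 : ℝ) / SC)) / (2 * Real.sqrt ((q0 : ℝ) / SC)) ∈ Icc ((Dlo : ℝ) / SC) ((Dhi : ℝ) / SC) := by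
  have hq := FI.mem_ofScaled q0
  unfold derivOK2 at h
  simp only [Bool.and_eq_true, decide_eq_true_eq] at h
  obtain ⟨hq0, h⟩ := h
  have hQ : 0 < (FI.ofScaled q0).lo := hq0
  have hpos : (0:ℝ) < (q0 : ℝ) / SC := div_pos (by exact_mod_cast hq0) SC_pos
  have hS := SC_pos
  split_ifs at h with c1 c2 c3
  · -- bump
    simp only [Bool.and_eq_true, decide_eq_true_eq] at h
    obtain ⟨⟨⟨hS1, hS2⟩, hL⟩, hU⟩ := h
    set P1 := FI.mul (eBumpC2 (FI.ofScaled q0)) (mulRat (FI.ofScaled (sqrtW (FI.ofScaled q0)).lo) 5 4) with hP1d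
    set P2 := FI.mul (eBumpC2 (FI.ofScaled q0)) (mulRat (FI.ofScaled (sqrtW (FI.ofScaled q0)).hi) 5 4) with hP2d
    have h64 : (q0 : ℝ) / SC ≤ 64 / 25 := div_SC_le_of (by norm_num) (by simpa using c1)
    obtain ⟨hlo0, hlo2⟩ := sqrtWLo_nonneg_sq_le hq hS1 hpos.le
    obtain ⟨hhi2, hhi0⟩ := le_sqrtWHi_sq hq hS2
    have hC := mem_eBumpC2 hq
    have hm1 := FI.mem_mul hC (mem_mulRat (FI.mem_ofScaled (sqrtW (FI.ofScaled q0)).lo) 5 (q := 4) (by norm_num))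
    have hm2 := FI.mem_mul hC (mem_mulRat (FI.mem_ofScaled (sqrtW (FI.ofScaled q0)).hi) 5 (q := 4) (by norm_num))
    rw [← hP1d] at hm1
    rw [← hP2d] at hm2
    have e1 : ∀ t : ℝ, -(3 / 256) * ((25 * ((q0 : ℝ) / SC) / 16) * (-(385 / 64) + 231 / 256 * (25 * ((q0 : ℝ) / SC) / 16) -
        99 / 1024 * (25 * ((q0 : ℝ) / SC) / 16) ^ 2 + 55 / 12288 * (25 * ((q0 : ℝ) / SC) / 16) ^ 3)) * ((5 : ℤ) / ((4 : ℕ) : ℝ) * t) =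
        -(3 / 256) * ((25 * ((q0 : ℝ) / SC) / 16) * (-(385 / 64) + 231 / 256 * (25 * ((q0 : ℝ) / SC) / 16) -
        99 / 1024 * (25 * ((q0 : ℝ) / SC) / 16) ^ 2 + 55 / 12288 * (25 * ((q0 : ℝ) / SC) / 16) ^ 3)) * (5 * t / 4) := by
      intro t; push_cast; ring
    rw [e1] at hm1 hm2
    have a1 := FI.lo_div_le hm1
    have a2 := FI.lo_div_le hm2
    have b1 := FI.le_hi_div hm1
    have b2 := FI.le_hi_div hm2
    have hmn1 : ((min P1.lo P2.lo : ℤ) : ℝ) ≤ P1.lo := by exact_mod_cast min_le_left _ _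
    have hmn2 : ((min P1.lo P2.lo : ℤ) : ℝ) ≤ P2.lo := by exact_mod_cast min_le_right _ _
    have hmx1 : (P1.hi : ℝ) ≤ ((max P1.hi P2.hi : ℤ) : ℝ) := by exact_mod_cast le_max_left _ _
    have hmx2 : (P2.hi : ℝ) ≤ ((max P1.hi P2.hi : ℤ) : ℝ) := by exact_mod_cast le_max_right _ _
    have hmain := dphi45_bump_mem_of_endpoints (Blo := ((min P1.lo P2.lo : ℤ) : ℝ) / SC) (Bhi := ((max P1.hi P2.hi : ℤ) : ℝ) / SC)
      hpos h64 hlo0 hlo2 hhi0 hhi2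
      ((div_le_div_of_nonneg_right hmn1 hS.le).trans a1) ((div_le_div_of_nonneg_right hmn2 hS.le).trans a2)
      (b1.trans (div_le_div_of_nonneg_right hmx1 hS.le)) (b2.trans (div_le_div_of_nonneg_right hmx2 hS.le))
    have hE2lo := FI.lo_div_le (mem_eBumpE2 hq hQ)
    have hE2hi := FI.le_hi_div (mem_eBumpE2 hq hQ)
    have hL' : (Dlo : ℝ) ≤ ((eBumpE2 (FI.ofScaled q0)).lo : ℝ) + ((min P1.lo P2.lo : ℤ) : ℝ) := by exact_mod_cast hL
    have hU' : ((eBumpE2 (FI.ofScaled q0)).hi : ℝ) + ((max P1.hi P2.hi : ℤ) : ℝ) ≤ Dhi := by exact_mod_cast hU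
    have hL'' := div_le_div_of_nonneg_right hL' hS.le
    have hU'' := div_le_div_of_nonneg_right hU' hS.le
    rw [add_div] at hL'' hU''
    exact ⟨by linarith [hmain.1], by linarith [hmain.2]⟩
  · -- LJ
    simp only [Bool.and_eq_true, decide_eq_true_eq] at h
    obtain ⟨hL, hU⟩ := h
    have h64 : (64 : ℝ) / 25 ≤ (q0 : ℝ) / SC := by
      have : ¬ (25 * q0 ≤ 64 * (SC : ℤ)) := c1
      have h' : 64 * (SC : ℤ) ≤ 25 * q0 := by linarith [not_le.1 this]
      exact le_div_SC_of (by norm_num) (by simpa using h')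
    have h9 : (q0 : ℝ) / SC ≤ 9 := by
      have h' : (1:ℕ) * q0 ≤ 9 * (SC : ℤ) := by push_cast; linarith
      exact (div_SC_le_of (by norm_num) h').trans (by norm_num)
    rw [dphi45_eq_lj h64 h9]
    have hm := mem_eGlj hq hQ
    exact ⟨le_trans (div_le_div_of_nonneg_right (by exact_mod_cast hL) hS.le) (FI.lo_div_le hm),
      le_trans (FI.le_hi_div hm) (div_le_div_of_nonneg_right (by exact_mod_cast hU) hS.le)⟩
  · -- window
    simp only [Bool.and_eq_true, decide_eq_true_eq] at h
    obtain ⟨⟨⟨hS1, hS2⟩, hL⟩, hU⟩ := h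
    have h9 : (9 : ℝ) ≤ (q0 : ℝ) / SC := by
      have : ¬ (q0 ≤ 9 * (SC : ℤ)) := c2
      have h' : 9 * (SC : ℤ) ≤ (1:ℕ) * q0 := by push_cast; linarith [not_le.1 this]
      exact le_trans (by norm_num) (le_div_SC_of (by norm_num) h')
    have h81 : (q0 : ℝ) / SC ≤ 81 / 4 := div_SC_le_of (by norm_num) (by simpa using c3)
    have hlo : (0:ℝ) < ((sqrtW (FI.ofScaled q0)).lo : ℝ) / SC := div_pos (by exact_mod_cast hS1) hS
    have hlo2 := sqrtWLo_sq_le hq hS1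
    obtain ⟨hhi2, hhi0⟩ := le_sqrtWHi_sq hq hS2
    have hS2' : 0 < (sqrtW (FI.ofScaled q0)).hi := by
      have : (((sqrtW (FI.ofScaled q0)).lo : ℝ) / SC) ^ 2 ≤ (((sqrtW (FI.ofScaled q0)).hi : ℝ) / SC) ^ 2 := hlo2.trans hhi2
      have h' := (pow_le_pow_iff_left₀ hlo.le hhi0 two_ne_zero).1 this
      have h'' : (0:ℝ) < ((sqrtW (FI.ofScaled q0)).hi : ℝ) / SC := hlo.trans_le h'
      have h3 : (0:ℝ) < ((sqrtW (FI.ofScaled q0)).hi : ℝ) := by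
        have := mul_pos h'' hS
        rwa [div_mul_cancel₀ _ hS.ne'] at this
      exact_mod_cast h3
    have hlow := dphi45_window_ge h9 h81 hlo hlo2 hhi0 hhi2
    have hupp := dphi45_window_le h9 h81 hlo hlo2 hhi0 hhi2
    have mL := FI.lo_div_le (mem_eWinDer hS2' hS1)
    have mU := FI.le_hi_div (mem_eWinDer hS1 hS2')
    exact ⟨le_trans (div_le_div_of_nonneg_right (by exact_mod_cast hL) hS.le) (mL.trans hlow),
      le_trans (hupp.trans mU) (div_le_div_of_nonneg_right (by exact_mod_cast hU) hS.le)⟩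
  · -- far
    simp only [Bool.and_eq_true, decide_eq_true_eq] at h
    obtain ⟨hL, hU⟩ := h
    have h81 : (81 : ℝ) / 4 ≤ (q0 : ℝ) / SC := by
      have : ¬ (4 * q0 ≤ 81 * (SC : ℤ)) := c3
      have h' : 81 * (SC : ℤ) ≤ 4 * q0 := by linarith [not_le.1 this]
      exact le_div_SC_of (by norm_num) (by simpa using h')
    rw [dphi45_eq_far h81]
    have hL' : (Dlo : ℝ) ≤ 0 := by exact_mod_cast hL
    have hU' : (0 : ℝ) ≤ Dhi := by exact_mod_cast hU
    exact ⟨div_nonpos_of_nonpos_of_nonneg hL' hS.le, div_nonneg hU' hS.le⟩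

/-! ## §3. Kernel smoke tests beyond `q = 16` -/

/-- A window term with `q₀ = 18` (`r ≈ 4.24`): v2 value and derivative checks certify tight enclosures (v1 cannot: `FI.sqrt` is loose there). -/
example : (valLoOK2 (18 * (SC : ℤ)) (-(SC : ℤ) / 100000) && derivOK2 (18 * (SC : ℤ)) 0 ((SC : ℤ) / 100000)) = true := by decide +kernel

/-- A window range `[18, 18.05]`: v2 curvature check accepts `M/SC = 10⁻⁵`. -/
example : curvOK2 (18 * (SC : ℤ)) (18 * (SC : ℤ) + (SC : ℤ) / 20) ((SC : ℤ) / 100000) = true := by decide +kernel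

/-- The `81/4`-straddling range `[20.2, 20.3]` is now certifiable. -/
example : curvOK2 (202 * (SC : ℤ) / 10) (203 * (SC : ℤ) / 10) ((SC : ℤ) / 100000) = true := by decide +kernel

end Summit.AtomisticToContinuum.Crystallization.Theorems.FrustratedLawDichotomyStrainedPatchHomTermEvalW
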